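import Summits.QuantumFields.YangMills.Theses.AllWindowsColdBox
import Summits.QuantumFields.YangMills.Theorems.ColdBoxAllGroupsDefs
import Summits.QuantumFields.YangMills.Theorems.WeakCouplingRatesBulkDominatesColdBoxWDlrPlumbing
import Summits.QuantumFields.YangMills.Theorems.SoftLoopLongLagInnerFlatSurfaceGauss
import Summits.QuantumFields.YangMills.Theorems.ColdBoxAllGroupsBulkAllGroupsKernelGoodEventG
import Mathlib.MeasureTheory.Measure.Tilted

/-!
# Crux idea «fluctuation-response» — typed NODE on ⟨stmt-QuantumFields-24006⟩ `BulkMidWindowSU2`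
(ideator seat ym-idea-2 / crux-ideate seat 1, 2026-08-30; lens: FLUCTUATION–RESPONSE / LOCAL-COUPLING DIFFERENTIATION)

Targets = the two OPEN stubs of the registered skeleton LINE-18 v5 (sha16 3c750a37):
S6 `KernelMeanExpansionMidG` and S7 `KernelCovExpansionMidG` (restated VERBATIM in §0).

The lever: for the box kernel `μ = boxKernelG ρ β H ω` and the ONE-PLAQUETTE-MODULATED kernel
`μ_σ = μ.tilted (σ · (−β c_q))` (the Wilson weight of plaquette `q` changed from `β` to `(1+σ)β`), the exact identities
`∂_σ E_{μ_σ}[β c_p] = Cov_{μ_σ}(β c_p, −β c_q)` and `∂³_σ E_{μ_σ}[β c_p] = κ₄^{μ_σ}(β c_p; −β c_q, −β c_q, −β c_q)` turn the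
TWO-point expansion S7 into (P1) the ONE-point expansion S6 carried out for the modulated kernel, uniformly in `|σ| ≤ 2β^{−θ/2}`,
with the EXACT modulated Gaussian main term (Sherman–Morrison: the Maxwell form `Q_D + σ λ_q λ_qᵀ` is a rank-one update), read through
a SYMMETRIC difference quotient at `σ₀ = 2β^{−θ/2}`, plus (P2) a crude `O(1)` bound on the fourth joint cumulant (no asymptotics) and
(P3) G-free tilt calculus.  `−∂_σ main(σ)|₀ = (D/2)K_pq² + 2β K_pq Σ_c F̄_c(p)F̄_c(q)` is the main term of S7 on the nose.

Pieces: P1 `ModulatedKernelMeanExpansionMidG` (UNDECIDED vs S7; ⊇ S6 at σ = 0), P2 `TiltedFourthCumulantBoundMidG` (WEAKER),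
P3 `TiltResponseCalculus` (WEAKER, pure Mathlib).  Compositions `kernelMeanExpansionMidG_of` (S6 ⟸ P1) and
`kernelCovExpansionMidG_of` (S7 ⟸ P1 ∧ P2 ∧ P3).  Typed ≠ proved: nothing here proves S6/S7, the crux, or the mass gap.
-/

noncomputable section

open MeasureTheory Filter ProbabilityTheory
open Literature.MathematicalPhysics.QuantumLattice
open Literature.MathematicalPhysics.QuantumFieldTheory
open Literature.MathematicalPhysics.QuantumFieldTheory.LatticeMaxwell
open Summit.QuantumFields.YangMills.Theorems.WeakCouplingRates
open Summit.QuantumFields.YangMills.Theorems.ColdBoxAllGroups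
open Summit.QuantumFields.YangMills.Theorems.FreeEnergyLogCoefficient (dimE)

namespace Summit.QuantumFields.YangMills.Cruxes.BulkMidWindowSU2.FluctuationResponse

/-! ## §0 The targets (stubs S6, S7 of LINE-18 v5), verbatim -/

/-- TARGET S6 (verbatim from the registered skeleton v5). -/
def KernelMeanExpansionMidG : Prop :=
  ∀ θ : ℝ, 0 < θ → θ ≤ 1 / 16 →
    KernelMeanExpansionG (G := Matrix.specialUnitaryGroup (Fin 2) ℂ) (fundamentalRep (Fin 2)) θ (θ / 5)

/-- TARGET S7 (verbatim from the registered skeleton v5). -/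
def KernelCovExpansionMidG : Prop :=
  ∀ θ : ℝ, 0 < θ → θ ≤ 1 / 16 →
    KernelCovExpansionG (G := Matrix.specialUnitaryGroup (Fin 2) ℂ) (fundamentalRep (Fin 2)) (θ / 20) θ (θ / 5)

/-! ## §1 Vocabulary (helper defs; every constant an existing declaration) -/

/-- The fourth joint cumulant `κ₄^ν(X; Y, Y, Y) = E[X̃ Ỹ³] − 3 E[X̃ Ỹ] E[Ỹ²]` (`X̃ = X − E X`, `Ỹ = Y − E Y`) — the third
`σ`-derivative of `σ ↦ E_{ν.tilted (σ Y)}[X]` at `σ = 0`. -/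
def jointCum4 {Ω : Type*} [MeasurableSpace Ω] (ν : Measure Ω) (X Y : Ω → ℝ) : ℝ :=
  (∫ z, (X z - ∫ w, X w ∂ν) * (Y z - ∫ w, Y w ∂ν) ^ 3 ∂ν) -
    3 * (∫ z, (X z - ∫ w, X w ∂ν) * (Y z - ∫ w, Y w ∂ν) ∂ν) * (∫ z, (Y z - ∫ w, Y w ∂ν) ^ 2 ∂ν)

/-- The background flux `F̄ = sCirc (glue ϑ (mean ϑ))` of the harmonic (Maxwell-minimising) extension of a one-colour Dirichlet datum `ϑ`
into the cold box `H`, at plaquette `P` — exactly the expression appearing in `KernelMeanExpansionG` / `KernelCovExpansionG`. -/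
def bgFlux (H : ℕ) (ϑ : Literature.MathematicalPhysics.QuantumLattice.ZdEdge 4 → ℝ) (P : Plaq 4) : ℝ :=
  LatticeMaxwell.sCirc (LatticeMaxwell.glue (pin := fun e => e ∉ dirFreeEdges H) dirCorner (2 * H + 3) ϑ
    (LatticeMaxwell.mean (fun e => e ∉ dirFreeEdges H) dirCorner (2 * H + 3) ϑ)) P

/-- The MODULATED Gaussian main term.  Tilting the box kernel by `exp(−σ β c_q)` changes, at Gaussian order, the Dirichlet Maxwell form
`Q_D` to `Q_D + σ λ_q λ_qᵀ` (rank one); by Sherman–Morrison the fluctuation variance of `s_p` becomes `K_pp − σK_pq²/(1+σK_qq)` and the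
harmonic-extension flux becomes `F̄_c(p) − σ K_pq F̄_c(q)/(1+σ K_qq)` (deep `q`: no pinned edges), so the modulated one-point main term is
this EXACT rational function of `σ` in the `σ = 0` data `K_pp, K_pq, K_qq, F̄_c(p), F̄_c(q)`.  At `σ = 0` it is S6's main term;
`−∂_σ|₀` of it is S7's main term. -/
def modulatedMain {D : ℕ} (β σ Kpp Kpq Kqq : ℝ) (Fp Fq : Fin D → ℝ) : ℝ :=
  (D : ℝ) / 2 * (Kpp - σ * Kpq ^ 2 / (1 + σ * Kqq)) + β * ∑ c, (Fp c - σ * Kpq * Fq c / (1 + σ * Kqq)) ^ 2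

section Pieces

variable {N : ℕ} {G : Type} [Group G] [TopologicalSpace G] [IsTopologicalGroup G] [CompactSpace G]
  [MeasurableSpace G] [BorelSpace G]
variable (ρ : G →* Matrix (Fin N) (Fin N) ℂ)

/-- The one-plaquette-modulated box kernel: `boxKernelG ρ β H ω` tilted by `exp(σ · (−β c_{(y;1,2)}))`, i.e. the Wilson weight of the
single plaquette `(y;1,2)` moved from `β` to `(1+σ)β`. -/
def modKernelG (β : ℝ) (H : ℕ) (ω : LGConfig 4 G) (y : Literature.Probability.LatticeModels.Site 4) (σ : ℝ) :
    Measure (LGConfig 4 G) :=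
  (boxKernelG ρ β H ω).tilted (fun U => σ * (-(β * plaqCostAt ρ y 1 2 U)))

/-- **P1 (G-typed) — the MODULATED one-point expansion**, uniformly over crude-good data AND over modulation strengths
`|σ| ≤ 2β^{−θ/2}`: same data `ϑ c`, competitors `s c` and energy bound as `KernelMeanExpansionG`, chosen BEFORE `σ`; at every base point
`x` within `H/8` of the centre, with `q = x + ⌈β^A⌉e₀`: (i) the background fluxes at `p = (x;1,2)` and `q` are small,
`β Σ_c F̄_c² ≤ β^{9θ/20}` (true size `≲ β^{2δ}(log β)⁴`, `2δ = 8θ/20`); (ii) the modulated kernel mean of `β c_p` is the modulated Gaussian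
main term up to `β^{−θ}` — the precision of S6, not better. -/
def ModulatedKernelMeanExpansionG (A θ δ : ℝ) : Prop :=
  ∃ CE : ℝ, ∃ β₀ : ℝ, ∀ β : ℝ, β₀ ≤ β → ∀ ω : LGConfig 4 G, CrudeGoodG ρ β δ ⌈β ^ θ⌉₊ ω →
    ∃ ϑ : Fin (dimE ρ) → (Literature.MathematicalPhysics.QuantumLattice.ZdEdge 4 → ℝ), ∃ s : Fin (dimE ρ) → (DirFree ⌈β ^ θ⌉₊ → ℝ),
      (∑ c, LatticeMaxwell.formM (fun e => e ∉ dirFreeEdges ⌈β ^ θ⌉₊) dirCorner (2 * ⌈β ^ θ⌉₊ + 3) (ϑ c) (s c) ≤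
          CE * (2 * (⌈β ^ θ⌉₊ : ℝ) + 3) ^ 4 * β ^ (2 * δ - 1)) ∧
      ∀ x : Literature.Probability.LatticeModels.Site 4,
        (∀ m : Fin 4, 8 * |x m - (⌈β ^ θ⌉₊ : ℤ)| ≤ (⌈β ^ θ⌉₊ : ℤ)) →
          β * ∑ c, bgFlux ⌈β ^ θ⌉₊ (ϑ c) (x, 1, 2) ^ 2 ≤ β ^ (9 * θ / 20) ∧
          β * ∑ c, bgFlux ⌈β ^ θ⌉₊ (ϑ c) (x + Pi.single 0 (⌈β ^ A⌉₊ : ℤ), 1, 2) ^ 2 ≤ β ^ (9 * θ / 20) ∧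
          ∀ σ : ℝ, |σ| ≤ 2 * β ^ (-(θ / 2)) →
            |β * (∫ U, plaqCostAt ρ x 1 2 U ∂(modKernelG ρ β ⌈β ^ θ⌉₊ ω (x + Pi.single 0 (⌈β ^ A⌉₊ : ℤ)) σ)) -
                modulatedMain β σ
                  (boxDirProjKernel ⌈β ^ θ⌉₊ (x, 1, 2) (x, 1, 2))
                  (boxDirProjKernel ⌈β ^ θ⌉₊ (x, 1, 2) (x + Pi.single 0 (⌈β ^ A⌉₊ : ℤ), 1, 2))
                  (boxDirProjKernel ⌈β ^ θ⌉₊ (x + Pi.single 0 (⌈β ^ A⌉₊ : ℤ), 1, 2) (x + Pi.single 0 (⌈β ^ A⌉₊ : ℤ), 1, 2))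
                  (fun c => bgFlux ⌈β ^ θ⌉₊ (ϑ c) (x, 1, 2))
                  (fun c => bgFlux ⌈β ^ θ⌉₊ (ϑ c) (x + Pi.single 0 (⌈β ^ A⌉₊ : ℤ), 1, 2))| ≤ β ^ (-θ)

/-- **P2 (G-typed) — crude fourth-cumulant bound for the modulated kernel**: `|κ₄^{μ_σ}(β c_p; −β c_q, −β c_q, −β c_q)| ≤ M` uniformly in
`β ≥ β₀`, crude-good `ω` and `|σ| ≤ 2β^{−θ/2}` (`p` = centre plaquette, `q = p + ⌈β^A⌉e₀`).  Heuristic size `β⁴κ₄(c_p,c_q,c_q,c_q) =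
O(K_pq²) ≪ 1`; only `O(1)` is asked. -/
def TiltedFourthCumulantBoundG (A θ δ : ℝ) : Prop :=
  ∃ M : ℝ, ∃ β₀ : ℝ, ∀ β : ℝ, β₀ ≤ β → ∀ ω : LGConfig 4 G, CrudeGoodG ρ β δ ⌈β ^ θ⌉₊ ω →
    ∀ σ : ℝ, |σ| ≤ 2 * β ^ (-(θ / 2)) →
      |jointCum4 (modKernelG ρ β ⌈β ^ θ⌉₊ ω (boxCentre ⌈β ^ θ⌉₊ + Pi.single 0 (⌈β ^ A⌉₊ : ℤ)) σ)
          (fun U => β * plaqCostAt ρ (boxCentre ⌈β ^ θ⌉₊) 1 2 U)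
          (fun U => -(β * plaqCostAt ρ (boxCentre ⌈β ^ θ⌉₊ + Pi.single 0 (⌈β ^ A⌉₊ : ℤ)) 1 2 U))| ≤ M

end Pieces

/-- **P1 — `SU(2)`, `θ ≤ 1/16`, `δ = θ/5`, `A = θ/20`** (the parameters of S6/S7). -/
def ModulatedKernelMeanExpansionMidG : Prop :=
  ∀ θ : ℝ, 0 < θ → θ ≤ 1 / 16 →
    ModulatedKernelMeanExpansionG (G := Matrix.specialUnitaryGroup (Fin 2) ℂ) (fundamentalRep (Fin 2)) (θ / 20) θ (θ / 5)

/-- **P2 — `SU(2)`, same parameters.** -/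
def TiltedFourthCumulantBoundMidG : Prop :=
  ∀ θ : ℝ, 0 < θ → θ ≤ 1 / 16 →
    TiltedFourthCumulantBoundG (G := Matrix.specialUnitaryGroup (Fin 2) ℂ) (fundamentalRep (Fin 2)) (θ / 20) θ (θ / 5)

/-- **P3 — tilt/response calculus (G-free, pure probability).**  For bounded measurable `X, Y` on a probability space,
`g(σ) = E_{μ.tilted(σY)}[X]` is smooth with `g'(0) = Cov_μ(X,Y)` and `g''' (σ) = κ₄^{μ.tilted(σY)}(X;Y,Y,Y)`; Taylor with Lagrange remainder
for the symmetric difference quotient: `|(g(σ₀) − g(−σ₀))/(2σ₀) − Cov_μ(X,Y)| ≤ (M/6)σ₀²` whenever `|g'''| ≤ M` on `[−σ₀, σ₀]`. -/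
def TiltResponseCalculus : Prop :=
  ∀ (Ω : Type) [MeasurableSpace Ω] (μ : Measure Ω) [IsProbabilityMeasure μ] (X Y : Ω → ℝ) (B σ₀ M : ℝ),
    Measurable X → Measurable Y → (∀ z, |X z| ≤ B) → (∀ z, |Y z| ≤ B) → 0 < σ₀ →
    (∀ σ : ℝ, |σ| ≤ σ₀ → |jointCum4 (μ.tilted (fun z => σ * Y z)) X Y| ≤ M) →
      |((∫ z, X z ∂(μ.tilted (fun z => σ₀ * Y z))) - (∫ z, X z ∂(μ.tilted (fun z => (-σ₀) * Y z)))) / (2 * σ₀) -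
          ((∫ z, X z * Y z ∂μ) - (∫ z, X z ∂μ) * (∫ z, Y z ∂μ))| ≤ M / 6 * σ₀ ^ 2

/-! ## §2 Compositions -/

/-- S6 ⟸ P1 (take `σ = 0`: the modulated kernel is the kernel, the modulated main term is S6's main term). -/
theorem kernelMeanExpansionMidG_of (h₁ : ModulatedKernelMeanExpansionMidG) : KernelMeanExpansionMidG := by
  intro θ hθ hθ'
  obtain ⟨CE, β₀, h⟩ := h₁ θ hθ hθ'
  refine ⟨CE, max β₀ 1, fun β hβ ω hω => ?_⟩
  have hβ₀ : β₀ ≤ β := le_trans (le_max_left _ _) hβ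
  have hβ1 : (1 : ℝ) ≤ β := le_trans (le_max_right _ _) hβ
  obtain ⟨ϑ, s, hE, hx⟩ := h β hβ₀ ω hω
  refine ⟨ϑ, s, hE, fun x hxm => ?_⟩
  obtain ⟨-, -, hσ⟩ := hx x hxm
  have h0 := hσ 0 (by rw [abs_zero]; positivity)
  have hker : modKernelG (fundamentalRep (Fin 2)) β ⌈β ^ θ⌉₊ ω (x + Pi.single 0 (⌈β ^ (θ / 20)⌉₊ : ℤ)) 0 =
      boxKernelG (fundamentalRep (Fin 2)) β ⌈β ^ θ⌉₊ ω := by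
    haveI : IsProbabilityMeasure (boxKernelG (G := Matrix.specialUnitaryGroup (Fin 2) ℂ) (fundamentalRep (Fin 2)) β ⌈β ^ θ⌉₊ ω) :=
      isProbabilityMeasure_boxKernelG _ (continuous_fundamentalRep (Fin 2)) β _ ω
    simp only [modKernelG, zero_mul]
    exact tilted_const _ 0
  rw [hker] at h0
  simp only [modulatedMain, zero_mul, zero_div, sub_zero] at h0
  convert h0 using 2
  simp only [bgFlux]
  ring

/-! ### §2a Algebra of the symmetric difference quotient (pure real arithmetic) -/

theorem sum_sq_modulated_expand {D : ℕ} (Kpq Kqq σ : ℝ) (Fp Fq : Fin D → ℝ) :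
    ∑ c, (Fp c - σ * Kpq * Fq c / (1 + σ * Kqq)) ^ 2 =
      (∑ c, Fp c ^ 2) - 2 * (σ * Kpq / (1 + σ * Kqq)) * (∑ c, Fp c * Fq c) +
        (σ * Kpq / (1 + σ * Kqq)) ^ 2 * (∑ c, Fq c ^ 2) := by
  rw [Finset.mul_sum, Finset.mul_sum, ← Finset.sum_sub_distrib, ← Finset.sum_add_distrib]
  exact Finset.sum_congr rfl fun c _ => by ring

theorem two_abs_sum_mul_le {D : ℕ} (Fp Fq : Fin D → ℝ) :
    2 * |∑ c, Fp c * Fq c| ≤ (∑ c, Fp c ^ 2) + ∑ c, Fq c ^ 2 := by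
  calc 2 * |∑ c, Fp c * Fq c| ≤ 2 * ∑ c, |Fp c * Fq c| := by
        gcongr; exact Finset.abs_sum_le_sum_abs _ _
    _ = ∑ c, 2 * |Fp c| * |Fq c| := by
        rw [Finset.mul_sum]; exact Finset.sum_congr rfl fun c _ => by rw [abs_mul]; ring
    _ ≤ ∑ c, (|Fp c| ^ 2 + |Fq c| ^ 2) := Finset.sum_le_sum fun c _ => two_mul_le_add_sq _ _
    _ = (∑ c, Fp c ^ 2) + ∑ c, Fq c ^ 2 := by simp only [sq_abs, Finset.sum_add_distrib]

/-- The symmetric difference quotient at `±σ₀` of the modulated main term is MINUS S7's main term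
`P = (D/2)K_pq² + 2β(Σ_c F̄_c(p)F̄_c(q))K_pq`, up to `σ₀²(D + 8Φ)` (`Φ` = the flux-size bound of P1). -/
theorem modulatedMain_symmQuot_bound {D : ℕ} (β σ₀ Kpp Kpq Kqq Φ : ℝ) (Fp Fq : Fin D → ℝ)
    (hβ : 0 ≤ β) (hσ₀ : 0 < σ₀) (hσ₀' : σ₀ ≤ 1 / 2) (hKpq : |Kpq| ≤ 1) (hKqq : |Kqq| ≤ 1)
    (hFp : β * ∑ c, Fp c ^ 2 ≤ Φ) (hFq : β * ∑ c, Fq c ^ 2 ≤ Φ) :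
    |(modulatedMain β σ₀ Kpp Kpq Kqq Fp Fq - modulatedMain β (-σ₀) Kpp Kpq Kqq Fp Fq) / (2 * σ₀) +
        ((D : ℝ) / 2 * Kpq ^ 2 + 2 * β * (∑ c, Fp c * Fq c) * Kpq)| ≤ σ₀ ^ 2 * (D + 8 * Φ) := by
  obtain ⟨P, hP⟩ : ∃ P : ℝ, P = (D : ℝ) / 2 * Kpq ^ 2 + 2 * β * (∑ c, Fp c * Fq c) * Kpq := ⟨_, rfl⟩
  obtain ⟨R, hR⟩ : ∃ R : ℝ, R = β * Kpq ^ 2 * ∑ c, Fq c ^ 2 := ⟨_, rfl⟩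
  have hmain : ∀ σ : ℝ, modulatedMain β σ Kpp Kpq Kqq Fp Fq =
      ((D : ℝ) / 2 * Kpp + β * ∑ c, Fp c ^ 2) - P * (σ / (1 + σ * Kqq)) + R * (σ / (1 + σ * Kqq)) ^ 2 := by
    intro σ
    rw [hP, hR]
    unfold modulatedMain
    rw [sum_sq_modulated_expand]
    ring
  rw [← hP]
  -- elementary bounds
  have hKqq2 : Kqq ^ 2 ≤ 1 := by
    have h := abs_le.mp hKqq
    nlinarith [h.1, h.2]
  have hKpq2 : Kpq ^ 2 ≤ 1 := by
    have h := abs_le.mp hKpq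
    nlinarith [h.1, h.2]
  have hsK : σ₀ * |Kqq| ≤ 1 / 2 := by
    calc σ₀ * |Kqq| ≤ σ₀ * 1 := by gcongr
      _ ≤ 1 / 2 := by linarith
  have h1 : 1 + σ₀ * Kqq ≠ 0 := by
    have : σ₀ * Kqq ≥ -(1 / 2) := by
      have := neg_abs_le Kqq
      nlinarith [this, hσ₀.le]
    linarith
  have h2 : 1 + (-σ₀) * Kqq ≠ 0 := by
    have : σ₀ * Kqq ≤ 1 / 2 := by
      have := le_abs_self Kqq
      nlinarith [this, hσ₀.le]
    linarith
  have hd1 : 3 / 4 ≤ 1 - σ₀ ^ 2 * Kqq ^ 2 := by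
    have : σ₀ ^ 2 * Kqq ^ 2 ≤ 1 / 4 := by
      have hsq : σ₀ ^ 2 * Kqq ^ 2 = (σ₀ * |Kqq|) ^ 2 := by rw [mul_pow, sq_abs]
      rw [hsq]
      have h0 : 0 ≤ σ₀ * |Kqq| := by positivity
      nlinarith [hsK, h0]
    linarith
  have hd2 : 1 - σ₀ ^ 2 * Kqq ^ 2 ≤ 1 := by nlinarith [sq_nonneg σ₀, sq_nonneg Kqq, mul_nonneg (sq_nonneg σ₀) (sq_nonneg Kqq)]
  have h4 : 1 - σ₀ ^ 2 * Kqq ^ 2 ≠ 0 := by linarith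
  have hσne : σ₀ ≠ 0 := hσ₀.ne'
  have hup : σ₀ / (1 + σ₀ * Kqq) = σ₀ * (1 - σ₀ * Kqq) / (1 - σ₀ ^ 2 * Kqq ^ 2) := by
    rw [div_eq_div_iff h1 h4]; ring
  have hum : (-σ₀) / (1 + (-σ₀) * Kqq) = (-(σ₀ * (1 + σ₀ * Kqq))) / (1 - σ₀ ^ 2 * Kqq ^ 2) := by
    rw [div_eq_div_iff h2 h4]; ring
  have hid : (modulatedMain β σ₀ Kpp Kpq Kqq Fp Fq - modulatedMain β (-σ₀) Kpp Kpq Kqq Fp Fq) / (2 * σ₀) + P =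
      -(σ₀ ^ 2 * (P * Kqq ^ 2 * (1 - σ₀ ^ 2 * Kqq ^ 2) + 2 * R * Kqq) / (1 - σ₀ ^ 2 * Kqq ^ 2) ^ 2) := by
    rw [hmain, hmain, hup, hum]
    field_simp
    ring
  -- sizes of P and R
  have hΦ : 0 ≤ Φ := le_trans (mul_nonneg hβ (Finset.sum_nonneg fun c _ => sq_nonneg (Fp c))) hFp
  have hPabs : |P| ≤ (D : ℝ) / 2 + 2 * Φ := by
    rw [hP]
    refine (abs_add_le _ _).trans (add_le_add ?_ ?_)
    · rw [abs_mul, abs_of_nonneg (by positivity : (0 : ℝ) ≤ (D : ℝ) / 2), abs_of_nonneg (sq_nonneg _)]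
      calc (D : ℝ) / 2 * Kpq ^ 2 ≤ (D : ℝ) / 2 * 1 := by gcongr
        _ = (D : ℝ) / 2 := by ring
    · rw [abs_mul, abs_mul, abs_mul, abs_of_nonneg hβ, abs_two]
      calc 2 * β * |∑ c, Fp c * Fq c| * |Kpq| ≤ 2 * β * |∑ c, Fp c * Fq c| * 1 := by gcongr
        _ = β * (2 * |∑ c, Fp c * Fq c|) := by ring
        _ ≤ β * ((∑ c, Fp c ^ 2) + ∑ c, Fq c ^ 2) := by gcongr; exact two_abs_sum_mul_le Fp Fq
        _ = β * ∑ c, Fp c ^ 2 + β * ∑ c, Fq c ^ 2 := by ring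
        _ ≤ Φ + Φ := add_le_add hFp hFq
        _ = 2 * Φ := by ring
  have hRabs : |R| ≤ Φ := by
    rw [hR, abs_of_nonneg (by positivity)]
    calc β * Kpq ^ 2 * ∑ c, Fq c ^ 2 ≤ β * 1 * ∑ c, Fq c ^ 2 := by gcongr
      _ = β * ∑ c, Fq c ^ 2 := by ring
      _ ≤ Φ := hFq
  have hnum : |P * Kqq ^ 2 * (1 - σ₀ ^ 2 * Kqq ^ 2) + 2 * R * Kqq| ≤ |P| + 2 * |R| := by
    refine (abs_add_le _ _).trans (add_le_add ?_ ?_)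
    · rw [abs_mul, abs_mul, abs_of_nonneg (sq_nonneg Kqq), abs_of_nonneg (by linarith : (0 : ℝ) ≤ 1 - σ₀ ^ 2 * Kqq ^ 2)]
      calc |P| * Kqq ^ 2 * (1 - σ₀ ^ 2 * Kqq ^ 2) ≤ |P| * 1 * 1 := by gcongr
        _ = |P| := by ring
    · rw [abs_mul, abs_mul, abs_two]
      calc 2 * |R| * |Kqq| ≤ 2 * |R| * 1 := by gcongr
        _ = 2 * |R| := by ring
  have hdpos : 0 < (1 - σ₀ ^ 2 * Kqq ^ 2) ^ 2 := by positivity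
  rw [hid, abs_neg, abs_div, abs_mul, abs_of_nonneg (sq_nonneg σ₀), abs_of_nonneg hdpos.le, div_le_iff₀ hdpos]
  have hDΦ : (0 : ℝ) ≤ (D : ℝ) + 8 * Φ := by positivity
  calc σ₀ ^ 2 * |P * Kqq ^ 2 * (1 - σ₀ ^ 2 * Kqq ^ 2) + 2 * R * Kqq|
      ≤ σ₀ ^ 2 * (|P| + 2 * |R|) := by gcongr
    _ ≤ σ₀ ^ 2 * (((D : ℝ) / 2 + 2 * Φ) + 2 * Φ) := by gcongr
    _ = σ₀ ^ 2 * ((D : ℝ) + 8 * Φ) * (1 / 2) := by ring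
    _ ≤ σ₀ ^ 2 * ((D : ℝ) + 8 * Φ) * (1 - σ₀ ^ 2 * Kqq ^ 2) ^ 2 := by
        gcongr
        nlinarith [hd1]


/-- Bookkeeping of the three error sources (quotient vs covariance, P1 at `±σ₀`, main-term algebra). -/
theorem combine_bounds (ap am mp mm cov P σ₀ η B₁ B₃ : ℝ) (hσ₀ : 0 < σ₀)
    (hq : |(ap - am) / (2 * σ₀) - cov| ≤ B₁) (hp : |ap - mp| ≤ η) (hm : |am - mm| ≤ η)
    (hE : |(mp - mm) / (2 * σ₀) + P| ≤ B₃) : |-cov - P| ≤ B₁ + η / σ₀ + B₃ := by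
  have e : -cov - P =
      ((ap - am) / (2 * σ₀) - cov) - ((ap - mp) - (am - mm)) / (2 * σ₀) - ((mp - mm) / (2 * σ₀) + P) := by ring
  have hx : |(ap - mp) - (am - mm)| ≤ η + η := (abs_sub _ _).trans (add_le_add hp hm)
  have hmid : |((ap - mp) - (am - mm)) / (2 * σ₀)| ≤ η / σ₀ := by
    calc |((ap - mp) - (am - mm)) / (2 * σ₀)| = |(ap - mp) - (am - mm)| / (2 * σ₀) := by
          rw [abs_div, abs_of_pos (by positivity : (0 : ℝ) < 2 * σ₀)]
      _ ≤ (η + η) / (2 * σ₀) := by gcongr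
      _ = η / σ₀ := by rw [← two_mul, mul_div_mul_left _ _ (two_ne_zero)]
  rw [e]
  have t1 := abs_sub ((ap - am) / (2 * σ₀) - cov - ((ap - mp) - (am - mm)) / (2 * σ₀)) ((mp - mm) / (2 * σ₀) + P)
  have t2 := abs_sub ((ap - am) / (2 * σ₀) - cov) (((ap - mp) - (am - mm)) / (2 * σ₀))
  linarith

/-! ### §2b S7 ⟸ P1 ∧ P2 ∧ P3 -/

/-- **S7 ⟸ P1 ∧ P2 ∧ P3** (kernel-checked composition).  With `s = β^{−θ/2}` (S7's precision), `σ₀ = 2s`, `η = β^{−θ}` (P1's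
precision), `Φ = β^{9θ/20}` (P1's flux size) and `M` (P2's cumulant bound): P3 gives `|sym. quotient − Cov(βc_p, −βc_q)| ≤ (M/6)σ₀²`,
P1 at `±σ₀` replaces the two modulated means by `modulatedMain(±σ₀)` at cost `2η/(2σ₀) = s/2`, and `modulatedMain_symmQuot_bound`
identifies the quotient of the main terms with MINUS S7's main term up to `σ₀²(D + 8Φ)`; total
`s/2 + 4s²(M/6 + D) + 32 s·(sΦ) ≤ s/2 + s/4 + s/4 = s` for `β ≥ β₀(θ, M)` (`sΦ = β^{−θ/20} → 0`).  No `sorry`; standard axioms. -/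
theorem kernelCovExpansionMidG_of (h₁ : ModulatedKernelMeanExpansionMidG) (h₂ : TiltedFourthCumulantBoundMidG)
    (h₃ : TiltResponseCalculus) : KernelCovExpansionMidG := by
  intro θ hθ hθ'
  obtain ⟨CE, β₁, hP1⟩ := h₁ θ hθ hθ'
  obtain ⟨M, β₂, hP2⟩ := h₂ θ hθ hθ'
  have t1 := tendsto_rpow_neg_atTop (show 0 < θ / 2 by positivity)
  have t2 := tendsto_rpow_neg_atTop (show 0 < θ / 20 by positivity)
  have e1 : ∀ᶠ β : ℝ in atTop, β ^ (-(θ / 2)) ≤ 1 / 4 := t1.eventually (eventually_le_nhds (by norm_num))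
  have e2 : ∀ᶠ β : ℝ in atTop, 16 * (|M| / 6 + (dimE (fundamentalRep (Fin 2)) : ℝ)) * β ^ (-(θ / 2)) ≤ 1 := by
    have t := t1.const_mul (16 * (|M| / 6 + (dimE (fundamentalRep (Fin 2)) : ℝ)))
    rw [mul_zero] at t
    exact t.eventually (eventually_le_nhds (by norm_num))
  have e3 : ∀ᶠ β : ℝ in atTop, 128 * β ^ (-(θ / 20)) ≤ 1 := by
    have t := t2.const_mul (128 : ℝ)
    rw [mul_zero] at t
    exact t.eventually (eventually_le_nhds (by norm_num))
  obtain ⟨β₃, hβ₃⟩ := Filter.eventually_atTop.1 (e1.and (e2.and (e3.and (eventually_ge_atTop 1))))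
  refine ⟨CE, max (max β₁ β₂) β₃, fun β hβ ω hω => ?_⟩
  have hβ₁ : β₁ ≤ β := le_trans (le_trans (le_max_left _ _) (le_max_left _ _)) hβ
  have hβ₂ : β₂ ≤ β := le_trans (le_trans (le_max_right _ _) (le_max_left _ _)) hβ
  obtain ⟨hs4, hMs, hΦs, hβ1⟩ := hβ₃ β (le_trans (le_max_right _ _) hβ)
  have hβpos : 0 < β := by linarith
  obtain ⟨ϑ, sc, hE, hx⟩ := hP1 β hβ₁ ω hω
  refine ⟨ϑ, sc, hE, ?_⟩
  have hdeep : ∀ m : Fin 4, 8 * |boxCentre ⌈β ^ θ⌉₊ m - (⌈β ^ θ⌉₊ : ℤ)| ≤ (⌈β ^ θ⌉₊ : ℤ) := by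
    intro m; simp [boxCentre]
  obtain ⟨hFp, hFq, hσ⟩ := hx (boxCentre ⌈β ^ θ⌉₊) hdeep
  have hspos : 0 < β ^ (-(θ / 2)) := Real.rpow_pos_of_pos hβpos _
  obtain ⟨σ₀, hσ₀def⟩ : ∃ σ₀ : ℝ, σ₀ = 2 * β ^ (-(θ / 2)) := ⟨_, rfl⟩
  rw [← hσ₀def] at hσ
  have hσ₀pos : 0 < σ₀ := by rw [hσ₀def]; positivity
  have hσ₀le : σ₀ ≤ 1 / 2 := by rw [hσ₀def]; linarith
  have hP2' : ∀ σ : ℝ, |σ| ≤ σ₀ → _ := fun σ hs => hP2 β hβ₂ ω hω σ (hσ₀def ▸ hs)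
  clear hx hP1 hP2
  -- abstract the second plaquette's base point (avoids a pathological unification of `_ + Pi.single _ _` elaborations)
  generalize hy : (boxCentre ⌈β ^ θ⌉₊ + Pi.single 0 (⌈β ^ (θ / 20)⌉₊ : ℤ) :
      Literature.Probability.LatticeModels.Site 4) = y at hFq hσ hP2' ⊢
  have hplus := hσ σ₀ (abs_of_pos hσ₀pos).le
  have hminus := hσ (-σ₀) (by rw [abs_neg, abs_of_pos hσ₀pos])
  haveI : IsProbabilityMeasure (boxKernelG (G := Matrix.specialUnitaryGroup (Fin 2) ℂ) (fundamentalRep (Fin 2)) β ⌈β ^ θ⌉₊ ω) :=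
    isProbabilityMeasure_boxKernelG _ (continuous_fundamentalRep (Fin 2)) β _ ω
  have hX : Measurable (fun U => β * plaqCostAt (fundamentalRep (Fin 2)) (boxCentre ⌈β ^ θ⌉₊) 1 2 U) :=
    (measurable_plaqCostAt _ 1 2).const_mul β
  have hY : Measurable (fun U => -(β * plaqCostAt (fundamentalRep (Fin 2)) y 1 2 U)) :=
    ((measurable_plaqCostAt _ 1 2).const_mul β).neg
  have hXb : ∀ U, |β * plaqCostAt (fundamentalRep (Fin 2)) (boxCentre ⌈β ^ θ⌉₊) 1 2 U| ≤ 4 * β := fun U => by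
    rw [abs_mul, abs_of_pos hβpos, mul_comm]
    exact mul_le_mul_of_nonneg_right (abs_plaqCostAt_le _ 1 2 U) hβpos.le
  have hYb : ∀ U, |-(β * plaqCostAt (fundamentalRep (Fin 2)) y 1 2 U)| ≤ 4 * β := fun U => by
    rw [abs_neg, abs_mul, abs_of_pos hβpos, mul_comm]
    exact mul_le_mul_of_nonneg_right (abs_plaqCostAt_le _ 1 2 U) hβpos.le
  have hcum : ∀ σ : ℝ, |σ| ≤ σ₀ →
      |jointCum4 ((boxKernelG (fundamentalRep (Fin 2)) β ⌈β ^ θ⌉₊ ω).tilted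
          (fun U => σ * (-(β * plaqCostAt (fundamentalRep (Fin 2)) y 1 2 U))))
        (fun U => β * plaqCostAt (fundamentalRep (Fin 2)) (boxCentre ⌈β ^ θ⌉₊) 1 2 U)
        (fun U => -(β * plaqCostAt (fundamentalRep (Fin 2)) y 1 2 U))| ≤ M := fun σ hs => hP2' σ hs
  have hq := h₃ (LGConfig 4 (Matrix.specialUnitaryGroup (Fin 2) ℂ))
    (boxKernelG (G := Matrix.specialUnitaryGroup (Fin 2) ℂ) (fundamentalRep (Fin 2)) β ⌈β ^ θ⌉₊ ω) _ _ (4 * β) σ₀ M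
    hX hY hXb hYb hσ₀pos hcum
  beta_reduce at hq
  have hg : ∀ σ : ℝ, (∫ U, β * plaqCostAt (fundamentalRep (Fin 2)) (boxCentre ⌈β ^ θ⌉₊) 1 2 U
      ∂((boxKernelG (fundamentalRep (Fin 2)) β ⌈β ^ θ⌉₊ ω).tilted
          (fun U => σ * (-(β * plaqCostAt (fundamentalRep (Fin 2)) y 1 2 U))))) =
      β * ∫ U, plaqCostAt (fundamentalRep (Fin 2)) (boxCentre ⌈β ^ θ⌉₊) 1 2 U
        ∂(modKernelG (fundamentalRep (Fin 2)) β ⌈β ^ θ⌉₊ ω y σ) := by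
    intro σ; rw [integral_const_mul]; rfl
  rw [hg σ₀, hg (-σ₀)] at hq
  have hcov : (∫ U, β * plaqCostAt (fundamentalRep (Fin 2)) (boxCentre ⌈β ^ θ⌉₊) 1 2 U *
        -(β * plaqCostAt (fundamentalRep (Fin 2)) y 1 2 U) ∂(boxKernelG (fundamentalRep (Fin 2)) β ⌈β ^ θ⌉₊ ω)) -
      (∫ U, β * plaqCostAt (fundamentalRep (Fin 2)) (boxCentre ⌈β ^ θ⌉₊) 1 2 U ∂(boxKernelG (fundamentalRep (Fin 2)) β ⌈β ^ θ⌉₊ ω)) *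
      (∫ U, -(β * plaqCostAt (fundamentalRep (Fin 2)) y 1 2 U) ∂(boxKernelG (fundamentalRep (Fin 2)) β ⌈β ^ θ⌉₊ ω)) =
      -(β ^ 2 * ((∫ U, plaqCostAt (fundamentalRep (Fin 2)) (boxCentre ⌈β ^ θ⌉₊) 1 2 U *
          plaqCostAt (fundamentalRep (Fin 2)) y 1 2 U ∂(boxKernelG (fundamentalRep (Fin 2)) β ⌈β ^ θ⌉₊ ω)) -
        (∫ U, plaqCostAt (fundamentalRep (Fin 2)) (boxCentre ⌈β ^ θ⌉₊) 1 2 U ∂(boxKernelG (fundamentalRep (Fin 2)) β ⌈β ^ θ⌉₊ ω)) *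
        (∫ U, plaqCostAt (fundamentalRep (Fin 2)) y 1 2 U ∂(boxKernelG (fundamentalRep (Fin 2)) β ⌈β ^ θ⌉₊ ω)))) := by
    have e1 : (∫ U, β * plaqCostAt (fundamentalRep (Fin 2)) (boxCentre ⌈β ^ θ⌉₊) 1 2 U *
        -(β * plaqCostAt (fundamentalRep (Fin 2)) y 1 2 U) ∂(boxKernelG (fundamentalRep (Fin 2)) β ⌈β ^ θ⌉₊ ω)) =
        -(β ^ 2 * ∫ U, plaqCostAt (fundamentalRep (Fin 2)) (boxCentre ⌈β ^ θ⌉₊) 1 2 U *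
          plaqCostAt (fundamentalRep (Fin 2)) y 1 2 U ∂(boxKernelG (fundamentalRep (Fin 2)) β ⌈β ^ θ⌉₊ ω)) := by
      rw [← integral_const_mul, ← integral_neg]; congr 1; ext U; ring
    rw [e1, integral_const_mul, integral_neg, integral_const_mul]; ring
  rw [hcov] at hq
  have hKpq' := Summit.QuantumFields.YangMills.Theorems.SoftLoopLongLag.abs_boxDirProjKernel_le_one (H := ⌈β ^ θ⌉₊)
    ⟨boxCentre ⌈β ^ θ⌉₊, ⟨((1 : Fin 4), (2 : Fin 4)), by decide⟩⟩ ⟨y, ⟨((1 : Fin 4), (2 : Fin 4)), by decide⟩⟩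
  have hKpq : |boxDirProjKernel ⌈β ^ θ⌉₊ (boxCentre ⌈β ^ θ⌉₊, 1, 2) (y, 1, 2)| ≤ 1 := hKpq'
  have hKqq' := Summit.QuantumFields.YangMills.Theorems.SoftLoopLongLag.abs_boxDirProjKernel_le_one (H := ⌈β ^ θ⌉₊)
    ⟨y, ⟨((1 : Fin 4), (2 : Fin 4)), by decide⟩⟩ ⟨y, ⟨((1 : Fin 4), (2 : Fin 4)), by decide⟩⟩
  have hKqq : |boxDirProjKernel ⌈β ^ θ⌉₊ (y, 1, 2) (y, 1, 2)| ≤ 1 := hKqq'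
  have hEq := modulatedMain_symmQuot_bound β σ₀
    (boxDirProjKernel ⌈β ^ θ⌉₊ (boxCentre ⌈β ^ θ⌉₊, 1, 2) (boxCentre ⌈β ^ θ⌉₊, 1, 2))
    (boxDirProjKernel ⌈β ^ θ⌉₊ (boxCentre ⌈β ^ θ⌉₊, 1, 2) (y, 1, 2))
    (boxDirProjKernel ⌈β ^ θ⌉₊ (y, 1, 2) (y, 1, 2))
    (β ^ (9 * θ / 20)) (fun c => bgFlux ⌈β ^ θ⌉₊ (ϑ c) (boxCentre ⌈β ^ θ⌉₊, 1, 2))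
    (fun c => bgFlux ⌈β ^ θ⌉₊ (ϑ c) (y, 1, 2))
    hβpos.le hσ₀pos hσ₀le hKpq hKqq hFp hFq
  beta_reduce at hEq
  have hA := combine_bounds _ _ _ _ _ _ σ₀ (β ^ (-θ)) _ _ hσ₀pos hq hplus hminus hEq
  have hs2 : β ^ (-θ) = (β ^ (-(θ / 2))) ^ 2 := by
    rw [← Real.rpow_natCast, ← Real.rpow_mul hβpos.le]; congr 1; push_cast; ring
  have hsΦ : β ^ (-(θ / 2)) * β ^ (9 * θ / 20) = β ^ (-(θ / 20)) := by
    rw [← Real.rpow_add hβpos]; congr 1; ring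
  have hΦnn : 0 ≤ β ^ (9 * θ / 20) := (Real.rpow_pos_of_pos hβpos _).le
  have hDnn : (0 : ℝ) ≤ (dimE (fundamentalRep (Fin 2)) : ℝ) := Nat.cast_nonneg _
  have hsne : β ^ (-(θ / 2)) ≠ 0 := hspos.ne'
  have hnum : M / 6 * σ₀ ^ 2 + β ^ (-θ) / σ₀ +
      σ₀ ^ 2 * ((dimE (fundamentalRep (Fin 2)) : ℝ) + 8 * β ^ (9 * θ / 20)) ≤ β ^ (-(θ / 2)) := by
    rw [hs2, hσ₀def]
    calc M / 6 * (2 * β ^ (-(θ / 2))) ^ 2 + (β ^ (-(θ / 2))) ^ 2 / (2 * β ^ (-(θ / 2))) +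
          (2 * β ^ (-(θ / 2))) ^ 2 * ((dimE (fundamentalRep (Fin 2)) : ℝ) + 8 * β ^ (9 * θ / 20))
        = β ^ (-(θ / 2)) / 2 + 4 * (β ^ (-(θ / 2))) ^ 2 * (M / 6 + (dimE (fundamentalRep (Fin 2)) : ℝ)) +
            32 * β ^ (-(θ / 2)) * (β ^ (-(θ / 2)) * β ^ (9 * θ / 20)) := by
          field_simp; ring
      _ ≤ β ^ (-(θ / 2)) / 2 + 4 * (β ^ (-(θ / 2))) ^ 2 * (|M| / 6 + (dimE (fundamentalRep (Fin 2)) : ℝ)) +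
            32 * β ^ (-(θ / 2)) * (β ^ (-(θ / 2)) * β ^ (9 * θ / 20)) := by
          gcongr; exact le_abs_self M
      _ = β ^ (-(θ / 2)) / 2 + (β ^ (-(θ / 2)) / 4) * (16 * (|M| / 6 + (dimE (fundamentalRep (Fin 2)) : ℝ)) * β ^ (-(θ / 2))) +
            (β ^ (-(θ / 2)) / 4) * (128 * β ^ (-(θ / 20))) := by
          rw [hsΦ]; ring
      _ ≤ β ^ (-(θ / 2)) / 2 + (β ^ (-(θ / 2)) / 4) * 1 + (β ^ (-(θ / 2)) / 4) * 1 := by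
          gcongr
      _ = β ^ (-(θ / 2)) := by ring
  have hfin := hA.trans hnum
  rw [neg_neg] at hfin
  convert hfin using 2
  all_goals first | rfl | (simp only [bgFlux]; ring)

end Summit.QuantumFields.YangMills.Cruxes.BulkMidWindowSU2.FluctuationResponse

end
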